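import Literature.AlgebraicGeometry.Frobenioids.Categories
import Mathlib.CategoryTheory.Bicategory.Basic
import Mathlib.CategoryTheory.Comma.Over.Basic
import Mathlib.CategoryTheory.Equivalence
import Mathlib.CategoryTheory.EssentialImage
import HarnessLib

/-!
# Frobenioids I, Appendix: Slim Exponentiation

Mochizuki, *The geometry of Frobenioids I: the general theory*, Kyushu J. Math. **62** (2008)
293–400, Appendix "Slim Exponentiation", kurims text pp. 118–119
[cite: MochizukiFrdI2008, Appendix pp.118-119]: Definition A.1 (i) (2-slim 2-categories of
1-categories), (ii) (the coarsification `|D|`), Remark A.1.1 (the name), and Proposition A.2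
(Slim Exponentiation) with its proof:

> "Let `C` be a slim category [cf. §0]. Let `D` be the 2-category of 1-categories defined as
> follows: The objects of `D` are the categories `C_A` [cf. §0], where `A ∈ Ob(C)`. The
> 1-morphisms of `D` are the functors `f_! : C_A → C_B` [cf. §0] induced by morphisms `f : A → B`
> of `C`. The 2-morphisms of `D` are isomorphisms between these functors [cf. §0]. Then `D` is
> 2-slim. Moreover, the functor `E : C → |D|`, `A ↦ C_A`, `f ↦ f_!` determines an equivalence of
> categories `C ⥲ |D|`. We shall refer to the functor `E` as the slim exponentiation functor."

Renderings (recorded for the referee).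
* Definition A.1 (i), (ii) are stated for an arbitrary Mathlib `Bicategory` (`IsTwoSlim`,
  `Coarsification`): a "2-category of 1-categories" is in particular a bicategory, and neither
  definition uses that the objects are categories.
* The 2-category `D` of Proposition A.2 is not packaged as a `Bicategory` instance; instead its data
  are spelled out: objects = objects `A` of `C` (standing for the slice `C_A = Over A`),
  1-morphisms `A → B` = the functors `f_! = Over.map f` indexed by `f : A ⟶ B`, 2-morphisms
  `f_! ⇒ g_!` = natural isomorphisms `Over.map f ≅ Over.map g`. Accordingly "`D` is 2-slim" is
  rendered as: every `f_!` is a rigid functor (`IsRigidFunctor (Over.map f)`, §0 p. 14), and `|D|`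
  is the category `SliceCoarsification C` whose hom-sets are the quotients of `A ⟶ B` by
  `f ∼ g ⟺ f_! ≅ g_!`. Indexing 1-morphisms by `f` rather than by the functor `f_!` does not
  change `|D|` (two indices with the same functor are identified by the identity 2-morphism) and
  Proposition A.2 itself shows `f ↦ f_!` is injective up to isomorphism.
* Remark A.1.1 (the name "coarsification" comes from coarse moduli spaces) has no mathematical
  content and is recorded in the docstring of `Coarsification` only.
No statement of the paper is strengthened.
-/

namespace Literature.AlgebraicGeometry.Frobenioids

open CategoryTheory

universe w v u

/-! ### Definition A.1 (i): 2-slim bicategories -/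

section TwoSlim

open Bicategory

variable (B : Type u) [Bicategory.{w, v} B]

/-- A 2-category (here: any bicategory) is *2-slim* if every 1-morphism has no nontrivial
automorphisms, i.e. every 2-isomorphism `f ≅ f` is the identity (FrdI Def. A.1 (i), citing
[Mzk7] Def. 1.2.4 (iii)). [cite: MochizukiFrdI2008, Def. A.1(i) p.118] -/
@[mk_iff] structure IsTwoSlim : Prop where
  /-- every automorphism of every 1-morphism is trivial -/
  eq_refl : ∀ ⦃a b : B⦄ (f : a ⟶ b) (α : f ≅ f), α = Iso.refl f

/-! ### Definition A.1 (ii): the coarsification `|D|` -/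

/-- The objects of the *coarsification* `|B|` of a bicategory `B`: the objects of `B`
(FrdI Def. A.1 (ii): "the associated 1-category whose objects are objects of `D` and whose
morphisms are isomorphism classes of morphisms of `D`", citing [Mzk7] Def. 1.2.4 (iv); Remark
A.1.1: the name is motivated by coarse moduli spaces of fine moduli stacks).
[cite: MochizukiFrdI2008, Def. A.1(ii) p.118] -/
structure Coarsification (B : Type u) : Type u where
  /-- the underlying object of `B` -/
  as : B

namespace Coarsification

variable {B}

/-- Two 1-morphisms are identified in `|B|` when they are 2-isomorphic.
[cite: MochizukiFrdI2008, Def. A.1(ii) p.118] -/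
def homSetoid (a b : B) : Setoid (a ⟶ b) where
  r f g := Nonempty (f ≅ g)
  iseqv := ⟨fun f => ⟨Iso.refl f⟩, fun ⟨e⟩ => ⟨e.symm⟩, fun ⟨e⟩ ⟨e'⟩ => ⟨e ≪≫ e'⟩⟩

/-- `|B|` is a category: composition of isomorphism classes is well defined by whiskering, and
the associativity and unit constraints of `B` become equalities of classes
(FrdI Def. A.1 (ii)). [cite: MochizukiFrdI2008, Def. A.1(ii) p.118] -/
instance instCategory : Category.{v} (Coarsification B) where
  Hom a b := Quotient (homSetoid a.as b.as)
  id a := Quotient.mk _ (𝟙 a.as)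
  comp f g := Quotient.map₂ (fun f g => f ≫ g)
    (fun _ f' hf _ g' hg => ⟨whiskerRightIso (Classical.choice hf) _ ≪≫ whiskerLeftIso f' (Classical.choice hg)⟩) f g
  id_comp := by
    rintro a b ⟨f⟩
    exact Quotient.sound ⟨λ_ f⟩
  comp_id := by
    rintro a b ⟨f⟩
    exact Quotient.sound ⟨ρ_ f⟩
  assoc := by
    rintro a b c d ⟨f⟩ ⟨g⟩ ⟨h⟩
    exact Quotient.sound ⟨α_ f g h⟩

/-- The class of a 1-morphism in `|B|`. [cite: MochizukiFrdI2008, Def. A.1(ii) p.118] -/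
def homMk {a b : B} (f : a ⟶ b) : (⟨a⟩ : Coarsification B) ⟶ ⟨b⟩ := Quotient.mk _ f

/-- Two 1-morphisms have the same class in `|B|` iff they are 2-isomorphic.
[cite: MochizukiFrdI2008, Def. A.1(ii) p.118] -/
theorem homMk_eq_homMk_iff {a b : B} (f g : a ⟶ b) : homMk f = homMk g ↔ Nonempty (f ≅ g) :=
  ⟨fun h => Quotient.exact h, fun h => Quotient.sound h⟩

end Coarsification

end TwoSlim

/-! ### Proposition A.2: the 2-category of slices of a slim category -/

section SlimExponentiation

variable (C : Type u) [Category.{v} C]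

/-- The hom-relation of the coarsification `|D|` of the 2-category `D` of Prop. A.2: morphisms
`f, g : A ⟶ B` of `C` are identified when the functors `f_!, g_! : C_A → C_B` are isomorphic
(FrdI Prop. A.2, p.118). [cite: MochizukiFrdI2008, Prop. A.2 p.118] -/
def sliceHomSetoid (A B : C) : Setoid (A ⟶ B) where
  r f g := Nonempty (Over.map f ≅ Over.map g)
  iseqv := ⟨fun _ => ⟨Iso.refl _⟩, fun ⟨e⟩ => ⟨e.symm⟩, fun ⟨e⟩ ⟨e'⟩ => ⟨e ≪≫ e'⟩⟩

/-- The objects of `|D|` for the 2-category `D` of Prop. A.2: one object `C_A` for each object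
`A` of `C` (FrdI Prop. A.2, p.118). [cite: MochizukiFrdI2008, Prop. A.2 p.118] -/
structure SliceCoarsification (C : Type u) : Type u where
  /-- the object `A`, standing for the slice category `C_A` -/
  as : C

namespace SliceCoarsification

variable {C}

/-- `|D|` is a category: morphisms `C_A → C_B` are the classes of the functors `f_!`, `f : A ⟶ B`,
modulo isomorphism of functors; composition is induced by `(f ≫ g)_! ≅ f_! ⋙ g_!`
(FrdI Def. A.1 (ii) applied to the `D` of Prop. A.2). [cite: MochizukiFrdI2008, Prop. A.2 p.118] -/
instance instCategory : Category.{v} (SliceCoarsification C) where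
  Hom A B := Quotient (sliceHomSetoid C A.as B.as)
  id A := Quotient.mk _ (𝟙 A.as)
  comp f g := Quotient.map₂ (fun f g => f ≫ g)
    (fun f f' hf g g' hg =>
      ⟨Over.mapComp f g ≪≫ Functor.isoWhiskerRight (Classical.choice hf) (Over.map g) ≪≫
        Functor.isoWhiskerLeft (Over.map f') (Classical.choice hg) ≪≫ (Over.mapComp f' g').symm⟩)
    f g
  id_comp := by
    rintro A B ⟨f⟩
    exact congrArg (Quotient.mk _) (Category.id_comp f)
  comp_id := by
    rintro A B ⟨f⟩
    exact congrArg (Quotient.mk _) (Category.comp_id f)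
  assoc := by
    rintro A B X Y ⟨f⟩ ⟨g⟩ ⟨h⟩
    exact congrArg (Quotient.mk _) (Category.assoc f g h)

/-- The class `[f_!]` of `f` in `|D|`. [cite: MochizukiFrdI2008, Prop. A.2 p.118] -/
def homMk {A B : C} (f : A ⟶ B) : (⟨A⟩ : SliceCoarsification C) ⟶ ⟨B⟩ := Quotient.mk _ f

/-- `[f_!] = [g_!]` in `|D|` iff `f_! ≅ g_!`. [cite: MochizukiFrdI2008, Prop. A.2 p.118] -/
theorem homMk_eq_homMk_iff {A B : C} (f g : A ⟶ B) :
    homMk f = homMk g ↔ Nonempty (Over.map f ≅ Over.map g) :=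
  ⟨fun h => Quotient.exact h, fun h => Quotient.sound h⟩

/-- Every morphism of `|D|` is the class of some `f`. [cite: MochizukiFrdI2008, Prop. A.2 p.118] -/
theorem homMk_surjective {A B : SliceCoarsification C} (φ : A ⟶ B) :
    ∃ f : A.as ⟶ B.as, homMk f = φ :=
  Quotient.exists_rep φ

end SliceCoarsification

/-- The *slim exponentiation functor* `E : C → |D|`, `A ↦ C_A`, `f ↦ f_!` (FrdI Prop. A.2,
p.118). [cite: MochizukiFrdI2008, Prop. A.2 p.118] -/
def slimExponentiation : C ⥤ SliceCoarsification C where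
  obj A := ⟨A⟩
  map f := SliceCoarsification.homMk f
  map_id _ := rfl
  map_comp _ _ := rfl

variable {C}

/-- The key computation of the proof of Prop. A.2 (p.118–119): an isomorphism `f_! ≅ g_!`
composed with the natural functor `C_B → C` is an automorphism of the natural functor `C_A → C`,
hence trivial when `C` is slim; so the `C`-components of `f_! ≅ g_!` are identities.
[cite: MochizukiFrdI2008, Prop. A.2 p.119] -/
theorem left_app_eq_id_of_isSlim (hC : IsSlim C) {A B : C} {f g : A ⟶ B}
    (e : Over.map f ≅ Over.map g) (U : Over A) : (e.hom.app U).left = 𝟙 U.left := by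
  -- the induced automorphism of `C_A → C` (both composites `f_! ⋙ (C_B → C)`, `g_! ⋙ (C_B → C)`
  -- coincide with `C_A → C` on the nose)
  let β : Over.forget A ≅ Over.forget A := Functor.isoWhiskerRight e (Over.forget B)
  have hβ : β = Iso.refl _ := hC.isRigid_forget A β
  have := congrArg (fun i : Over.forget A ≅ Over.forget A => i.hom.app U) hβ
  simpa [β] using this

/-- **FrdI Prop. A.2**, first assertion: for a slim category `C` the 2-category `D` of slices is
2-slim, i.e. every functor `f_! : C_A → C_B` is rigid ("follows immediately from the assumption
that `C` is slim"). [cite: MochizukiFrdI2008, Prop. A.2 p.118] -/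
theorem isRigidFunctor_overMap (hC : IsSlim C) {A B : C} (f : A ⟶ B) :
    IsRigidFunctor (Over.map f) := by
  intro α
  ext U
  exact left_app_eq_id_of_isSlim hC α U

/-- **FrdI Prop. A.2**, proof: "it is immediate from the definitions that `E` is full".
[cite: MochizukiFrdI2008, Prop. A.2 p.118] -/
theorem slimExponentiation_full : (slimExponentiation C).Full where
  map_surjective φ := SliceCoarsification.homMk_surjective φ

/-- **FrdI Prop. A.2**, proof: "it is immediate from the definitions that `E` is … essentially
surjective". [cite: MochizukiFrdI2008, Prop. A.2 p.118] -/
theorem slimExponentiation_essSurj : (slimExponentiation C).EssSurj where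
  mem_essImage A := ⟨A.as, ⟨Iso.refl _⟩⟩

/-- **FrdI Prop. A.2**, proof: for slim `C`, `E` is faithful — an isomorphism `f_! ≅ g_!` induces
an automorphism of `C_A → C`, trivial by slimness, and evaluating at `id_A ∈ C_A` gives `f = g`
(p.118–119). [cite: MochizukiFrdI2008, Prop. A.2 p.119] -/
theorem slimExponentiation_faithful (hC : IsSlim C) : (slimExponentiation C).Faithful where
  map_injective {A B} f g h := by
    obtain ⟨e⟩ := (SliceCoarsification.homMk_eq_homMk_iff f g).mp h
    have h1 : (e.hom.app (Over.mk (𝟙 A))).left = 𝟙 A :=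
      left_app_eq_id_of_isSlim hC e (Over.mk (𝟙 A))
    -- the structure equation of the `C_B`-morphism `e_{id_A} : (id_A ≫ f) → (id_A ≫ g)`, with
    -- its source and target spelled as objects of `C`
    have h2 : @CategoryStruct.comp C _ A A B (e.hom.app (Over.mk (𝟙 A))).left (𝟙 A ≫ g) = 𝟙 A ≫ f :=
      Over.w (e.hom.app (Over.mk (𝟙 A)))
    rw [h1, Category.id_comp, Category.id_comp, Category.id_comp] at h2
    exact h2.symm

/-- **FrdI Prop. A.2** (Slim Exponentiation): if `C` is slim, then the 2-category `D` of slices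
`C_A` with the functors `f_!` and their isomorphisms is 2-slim, and the slim exponentiation
functor `E : C → |D|`, `A ↦ C_A`, `f ↦ f_!`, is an equivalence of categories.
[cite: MochizukiFrdI2008, Prop. A.2 p.118] -/
theorem slimExponentiation_isEquivalence (hC : IsSlim C) :
    (∀ ⦃A B : C⦄ (f : A ⟶ B), IsRigidFunctor (Over.map f)) ∧
      (slimExponentiation C).IsEquivalence :=
  ⟨fun _ _ f => isRigidFunctor_overMap hC f,
    { faithful := slimExponentiation_faithful hC
      full := slimExponentiation_full
      essSurj := slimExponentiation_essSurj }⟩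

end SlimExponentiation

end Literature.AlgebraicGeometry.Frobenioids
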